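import Summits.QuantumFields.YangMills.Theorems.BalabanLadderUVSeamRecCeilingsTemperedResponseCollar
import HarnessLib

/-!
# Crux `UVSeamRec` (stmt-QuantumFields-20043), stub `stub_ceilings` (E0′): the FUSED input — β-uniform joint exponential
# moments of the rescaled cube RESPONSES `R⁴·|kerE(plane)(η) − p|` already give `MomentBounds6` on every odd torus

Helper file (`--supports stmt-QuantumFields-20043`) of the width-lever seat `ym-20043-ceilings-p2` (lane B); sequel of
`…CeilingsTemperedResponseCollar.lean` (p530862: the tempered-response collar `∀η |kerE − p| ≤ ε(1 + Y(η))` plus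
`⟨exp Σ Y_i⟩ ≤ e^{B·#T}` ⇒ ceilings).  HONEST FRAMING: a consumption-side theorem for ONE open hypothesis (RM) about the
Wilson state on odd tori and its cube kernels; nothing of E0′ is claimed; not a gap, not Clay.

WHY (located finding of this seat, note `LANE-B-TEMPERED-RESPONSE-ceilings-p2.md` rev 2).  Two splittings of E0′ into a
kernel-side law and a measure-side bound are now known to be EMPTY as typed: (i) «good-exterior law at tolerance
`C₁/R⁴`» + «bad exteriors rare at rate `C₂/R⁴`» (p519295 / p528131 / p529130 side conditions) — the free-field response
`R⁴h/g² = −(c′/4)(N² − 1)` has a fixed law, so `μ(Bad) ↛ 0`; (ii) «response law `|h| ≤ (C₁/R⁴)(1 + Y)` with a BOUNDED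
influence functional `Y ≤ O(log R)`» (indicator / bounded-carrier polymer influences) — the lead's self-dual exteriors
(evidence #50: `|h| ≈ (1 − cos B)`, `B²b ≲ 10`) have `|h| ≈ 5/b ≍ R⁻¹ ≫ (C₁/R⁴)(1 + O(log R))`.  What survives is to
let the influence functional BE the rescaled response: with `Y := (R⁴/C₁)|kerE(plane)(η) − p|` the response law
(a′) of p530862 holds TAUTOLOGICALLY (`|h| ≤ C₁/R⁴ + |h|`), and the only remaining input is

  (RM)  `⟨exp(Σ_{i∈T} (R⁴/C₁)·|kerE_{cube i}(plane_i)(lift ·) − p_i|)⟩_{2L+1,β} ≤ exp(B·#T)`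

for cyclically separated cubes on every odd torus, `β ≥ β₁`, `1 ≤ R`, `R·a β ≤ ℓ₁` — β-UNIFORM `B`, NO rate, NO good/bad
split, NO reflection positivity, NO divisibility.  (RM) is consistent with everything on record: free field —
`Y_i = (c′g²/4C₁)|N_i² − 1|`, joint exponential moments by `det(1 − M)^{-1/2}` with the ℓ²-OPERATOR norm of the `F–F`
kernel (bounded Fourier symbol), `B = O(g²/C₁)` volume-uniform; coherent single-plane flux `f` per top block —
`Y ≍ f²`, weight `e^{−cβf²}`; self-dual / `B_sat` exteriors — `Y ≲ R³`, weight `≤ e^{−cβR³}`; all absorbed in `B`.  It is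
the natural OUTPUT of a background-field expansion of the cube kernel (response quadratic-plus-small in the exterior's
harmonic data) combined with Gaussian domination of local quadratic observables of the torus state.

* §1 **`momentBounds6_of_responseMoments`** — (RM) ⇒ `MomentBounds6 G r a` with `C = C₁ (2 + e^B) e^B` (all odd sides).
* §2 `momentBounds6OnSides_of_responseMoments` — the class twin (p464599 currency).

References: as p530862 (Georgii (2011) Thm. 4.17 for the DLR step; Glimm–Jaffe (1987) §9.1 for the free-field
calibration).
-/

set_option autoImplicit false

noncomputable section

open MeasureTheory Filter Topology Finset
open Literature.Probability.LatticeModels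
open Literature.MathematicalPhysics.QuantumFieldTheory (GaugeConfig wilsonMeasure isProbabilityMeasure_wilsonMeasure
  measurable_torusLift LatticeRep)
open Literature.MathematicalPhysics.QuantumLattice

namespace Summit.QuantumFields.YangMills.Cruxes.UVSeamRec.TemperedResponse

section Route

open Summit.QuantumFields.YangMills.Cruxes.OSLegsFromFemtoAndGap.DlrCollarTransfer
open Summit.QuantumFields.YangMills.Cruxes.UV.TorusClass

variable {G : Type} [Group G] [TopologicalSpace G] [IsTopologicalGroup G] [CompactSpace G]
  [MeasurableSpace G] [BorelSpace G] (r : LatticeRep G) (a : ℝ → ℝ)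

/-- The cube response `η ↦ kerE (plane q x)(η)` is continuous in the exterior (Feller property of the lattice
Yang–Mills specification, tree `continuous_integral_ymSpecification`). [folklore: Georgii (2011) §4.2] -/
theorem continuous_kerE_plane (β : ℝ) (c : Fin 4 → ℤ) (b : ℕ) (q : Fin 4 × Fin 4) (x : Fin 4 → ℤ) :
    Continuous fun η : LGConfig 4 G => kerE G r β c b η (plane G r q x) := by
  haveI : SecondCountableTopology G :=
    (r.continuous.isClosedEmbedding r.injective).isEmbedding.secondCountableTopology
  obtain ⟨CA, hCA⟩ := exists_abs_plane_le r
  exact continuous_integral_ymSpecification r.ρ r.continuous β (cubeEdges c b) (continuous_plane r q x) (hCA q x)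

/-- The cube response is bounded by the sup of the single-plane field. [folklore] -/
theorem abs_kerE_plane_le (β : ℝ) (c : Fin 4 → ℤ) (b : ℕ) (q : Fin 4 × Fin 4) (x : Fin 4 → ℤ) {CA : ℝ}
    (hCA : ∀ (q : Fin 4 × Fin 4) (x : Fin 4 → ℤ) (U : LGConfig 4 G), |plane G r q x U| ≤ CA) (η : LGConfig 4 G) :
    |kerE G r β c b η (plane G r q x)| ≤ CA := by
  haveI : SecondCountableTopology G :=
    (r.continuous.isClosedEmbedding r.injective).isEmbedding.secondCountableTopology
  exact abs_integral_ymSpecification_le r.ρ r.continuous β (cubeEdges c b) (hCA q x) η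

/-! ## §1 `MomentBounds6` from β-uniform joint exponential moments of the rescaled responses -/

/-- **`MomentBounds6 G r a` from (RM) alone — all odd sides.**  Let `p q β` be reference values (`|p| ≤ P₀`), `C₁ > 0`,
`B`, `ℓ₁ > 0`, `β₁`.  (RM): for `β ≥ β₁`, on every odd torus `(ℤ/(2L+1))⁴` with `4R+8 ≤ L`, `1 ≤ R`, `R·a β ≤ ℓ₁`, for
orientations `q i` (`(q i).1 < (q i).2`), sites `x i` pairwise cyclically `2R+4`-separated in some coordinate, and every
index set `T`,
`⟨exp(Σ_{i∈T} (R⁴/C₁)·|kerE_{x i − (R+1), 2R+3}(plane (q i) (x i))(lift U) − p (q i) β|)⟩_{2L+1,β} ≤ exp(B·#T)`.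
THEN `MomentBounds6 G r a` with `C = C₁ (2 + e^B) e^B`, `β₄ = β₁`, `ℓ₄ = ℓ₁`.  Proof: p530862's
`momentBounds6_of_temperedResponse` with the influence functional `Y := (R⁴/C₁)|kerE(plane)(η) − p|`, for which the
response law `|kerE − p| ≤ (C₁/R⁴)(1 + Y)` is an identity.  No good/bad split, no rarity rate, no reflection
positivity, no divisibility: (RM) is the single measure-side input of the odd-torus ceilings. [folklore: Georgii (2011)
Thm. 4.17 for the DLR part] -/
theorem momentBounds6_of_responseMoments {C₁ B β₁ ℓ₁ P₀ : ℝ} {p : Fin 4 × Fin 4 → ℝ → ℝ}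
    (hℓ₁ : 0 < ℓ₁) (hC₁ : 0 < C₁) (hp : ∀ q β, |p q β| ≤ P₀)
    (hRM : ∀ β : ℝ, β₁ ≤ β → ∀ (L n : ℕ) (q : Fin n → Fin 4 × Fin 4) (x : Fin n → (Fin 4 → ℤ)) (R : ℕ),
      (∀ i, (q i).1 < (q i).2) → 1 ≤ R → (R : ℝ) * a β ≤ ℓ₁ → 4 * R + 8 ≤ L →
      (∀ i j : Fin n, i ≠ j → ∃ k : Fin 4,
        (2 * (R : ℤ) + 4) ≤ |((((x i k - x j k : ℤ) : ZMod (2 * L + 1))).valMinAbs : ℤ)|) →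
      ∀ T : Finset (Fin n),
        torusE G r β L (fun U => Real.exp (∑ i ∈ T, (R : ℝ) ^ 4 / C₁ *
          |kerE G r β (fun k => x i k - (R + 1)) (2 * R + 3) U (plane G r (q i) (x i)) - p (q i) β|)) ≤
          Real.exp (B * T.card)) :
    MomentBounds6 G r a := by
  haveI : SecondCountableTopology G :=
    (r.continuous.isClosedEmbedding r.injective).isEmbedding.secondCountableTopology
  obtain ⟨CA, hCA⟩ := exists_abs_plane_le r
  have hP₀ : 0 ≤ P₀ := (abs_nonneg _).trans (hp (0, 1) 0)
  refine momentBounds6_of_temperedResponse r a (C₁ := C₁) (B := B) (β₁ := β₁) (ℓ₁ := ℓ₁) (P₀ := P₀) (p := p)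
    (fun β R q x η => (R : ℝ) ^ 4 / C₁ *
      |kerE G r β (fun k => x k - (R + 1)) (2 * R + 3) η (plane G r q x) - p q β|)
    (fun β R => (R : ℝ) ^ 4 / C₁ * (CA + P₀)) hℓ₁ hC₁.le hp ?_ ?_ ?_ ?_ hRM
  · -- measurability: the response is continuous in the exterior
    intro β R q x
    exact (((continuous_kerE_plane r β _ _ q x).sub continuous_const).abs.const_mul _).measurable
  · intro β R q x η
    positivity
  · intro β R q x η
    refine mul_le_mul_of_nonneg_left ?_ (by positivity)
    exact (abs_sub _ _).trans (add_le_add (abs_kerE_plane_le r β _ _ q x hCA η) (hp q β))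
  · -- the response law is an identity for this influence functional
    intro β hβ R hR hRa q x hq η
    have hR4 : (0 : ℝ) < (R : ℝ) ^ 4 := by positivity
    have hid : C₁ / (R : ℝ) ^ 4 * (1 + (R : ℝ) ^ 4 / C₁ *
        |kerE G r β (fun k => x k - (R + 1)) (2 * R + 3) η (plane G r q x) - p q β|) =
        C₁ / (R : ℝ) ^ 4 + |kerE G r β (fun k => x k - (R + 1)) (2 * R + 3) η (plane G r q x) - p q β| := by
      field_simp
    rw [hid]
    linarith [div_nonneg hC₁.le hR4.le]

/-! ## §2 The class currency likewise -/

/-- **`MomentBounds6OnSides G r a 𝓣` from (RM) on the tori of the class** — the twin of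
`momentBounds6_of_responseMoments` for the class-parametric ceilings (p464599; half-side clause `8R+16 ≤ M`), same
constant `C₁ (2 + e^B) e^B`. [folklore: Georgii (2011) Thm. 4.17 for the DLR part] -/
theorem momentBounds6OnSides_of_responseMoments (𝓣 : Set ℕ) {C₁ B β₁ ℓ₁ P₀ : ℝ} {p : Fin 4 × Fin 4 → ℝ → ℝ}
    (hℓ₁ : 0 < ℓ₁) (hC₁ : 0 < C₁) (hp : ∀ q β, |p q β| ≤ P₀)
    (hRM : ∀ β : ℝ, β₁ ≤ β → ∀ (M : ℕ) [NeZero M], M ∈ 𝓣 →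
      ∀ (n : ℕ) (q : Fin n → Fin 4 × Fin 4) (x : Fin n → (Fin 4 → ℤ)) (R : ℕ),
      (∀ i, (q i).1 < (q i).2) → 1 ≤ R → (R : ℝ) * a β ≤ ℓ₁ → 8 * R + 16 ≤ M →
      (∀ i j : Fin n, i ≠ j → ∃ k : Fin 4,
        (2 * (R : ℤ) + 4) ≤ |((((x i k - x j k : ℤ) : ZMod M)).valMinAbs : ℤ)|) →
      ∀ T : Finset (Fin n),
        torusEOn G r β M (fun U => Real.exp (∑ i ∈ T, (R : ℝ) ^ 4 / C₁ *
          |kerE G r β (fun k => x i k - (R + 1)) (2 * R + 3) U (plane G r (q i) (x i)) - p (q i) β|)) ≤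
          Real.exp (B * T.card)) :
    MomentBounds6OnSides G r a 𝓣 := by
  haveI : SecondCountableTopology G :=
    (r.continuous.isClosedEmbedding r.injective).isEmbedding.secondCountableTopology
  obtain ⟨CA, hCA⟩ := exists_abs_plane_le r
  have hP₀ : 0 ≤ P₀ := (abs_nonneg _).trans (hp (0, 1) 0)
  refine momentBounds6OnSides_of_temperedResponse r a 𝓣 (C₁ := C₁) (B := B) (β₁ := β₁) (ℓ₁ := ℓ₁) (P₀ := P₀)
    (p := p)
    (fun β R q x η => (R : ℝ) ^ 4 / C₁ *
      |kerE G r β (fun k => x k - (R + 1)) (2 * R + 3) η (plane G r q x) - p q β|)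
    (fun β R => (R : ℝ) ^ 4 / C₁ * (CA + P₀)) hℓ₁ hC₁.le hp ?_ ?_ ?_ ?_ hRM
  · intro β R q x
    exact (((continuous_kerE_plane r β _ _ q x).sub continuous_const).abs.const_mul _).measurable
  · intro β R q x η
    positivity
  · intro β R q x η
    refine mul_le_mul_of_nonneg_left ?_ (by positivity)
    exact (abs_sub _ _).trans (add_le_add (abs_kerE_plane_le r β _ _ q x hCA η) (hp q β))
  · intro β hβ R hR hRa q x hq η
    have hR4 : (0 : ℝ) < (R : ℝ) ^ 4 := by positivity
    have hid : C₁ / (R : ℝ) ^ 4 * (1 + (R : ℝ) ^ 4 / C₁ *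
        |kerE G r β (fun k => x k - (R + 1)) (2 * R + 3) η (plane G r q x) - p q β|) =
        C₁ / (R : ℝ) ^ 4 + |kerE G r β (fun k => x k - (R + 1)) (2 * R + 3) η (plane G r q x) - p q β| := by
      field_simp
    rw [hid]
    linarith [div_nonneg hC₁.le hR4.le]

end Route

end Summit.QuantumFields.YangMills.Cruxes.UVSeamRec.TemperedResponse

end
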